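import Summits.SmoothPoincare4.SmoothPoincare4.Theses.CongruenceShadows
import HarnessLib
import HarnessLib.Audit

/-!
# Line `finitary-ac-central-residue` for crux `CongruenceShadows.ShadowsStandard` (stmt-SmoothPoincare4-14593)

Skeleton (crux-plan, round 1; idea `finitary-ac-central-residue`, ideator 2; triage r1-1/2/3: pass ×3,
sharpenings answered in `Lines/finitary-ac-central-residue.md`).

**Thesis of the line.** Seen from inside the first handlebody and modulo a characteristic level,
everything a trisection of `{1}` shows is standard by Borovik–Lubotzky–Myasnikov's FINITARY
Andrews–Curtis theorem; what survives is ONE double intersection `N₀M ∩ K₂M`, and a two-level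
RESIDUE LEMMA (proved here) turns Goeritz-rigidity of that intersection into the crux, the loss of
one level being paid for by the (effective) centrelessness of normal subgroups of free profinite
groups (Melnikov).  No profinite object, no compactness and no coherent family appears in the
composition: the card's `IntersectionRigidity^coh` is replaced by its LEVEL-WISE form (Stub 3) plus
an effective two-level centre-killing statement (Stub 4).

Notation (existing declarations only): `S = SurfaceGroup (3+3m)`, `N = s4Kernels.stabilizeIter m`
(standard balanced triple of `S⁴`, `k = m+1`), `F = S ⧸ N 0` (`= π₁(H₀) ≅ F_{3k}`),
`π = QuotientGroup.mk' (N 0)`, `R₁ = π(N 1)` (normal closure of the `2k` "tails"), levels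
`M' ≤ M` characteristic of finite index in `S`.

Chain (each arrow a registered stub; all glue between them is PROVED in this file):

  crux data `m, K, hK, M` and the route item `WaldhausenPairs` (hypothesis `hW`, item 14592)
  —[proved: slot normalisation by `hW m K hK 0 1` + `Aut S`-transport of every hypothesis and of
     the conclusion (`isGroupTrisection_map`, `undo`)]→ WLOG `K 0 = N 0`, `K 1 = N 1`
  —[Stub 4 `stub_effectiveCentreless` ×2 (pairs `(N 0, N 2)` and `(N 0, K 2)`): a deeper level
     `M' ≤ M` at which "central in `N 0` modulo `X ⊔ M'` ⇒ inside `X ⊔ M`"]→ `M'`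
  —[Stub 1 `stub_finitaryAC` at level `M'` (BLM in `G = F_k/W` on the tail tuple + Nielsen +
     reservoir, inside `Stab_{Aut F}(R₁)`)]→ `θ ∈ Aut F`, `θ(R₁) = R₁`, `θ(π(N 2 ⊔ M')) = π(K 2 ⊔ M')`
  —[Stub 2 `stub_goeritzRealisation` (`Stab_{Aut F}(R₁)` is realised by `St₀ ∩ St₁`)]→
     `χ ∈ Aut S`, `χ(N 0) = N 0`, `χ(N 1) = N 1`, `χ̄ = θ`; proved (`sup_map_of_quotient`):
     `χ(N 2 ⊔ M' ⊔ N 0) = K 2 ⊔ M' ⊔ N 0`; replace `K` by `K' = χ⁻¹ • K` (slot-normalised, and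
     `K' 2 ⊔ N 0 ⊔ M' = N 2 ⊔ N 0 ⊔ M'`)
  —[Stub 3 `stub_intersectionRigidity` (the RESIDUE CRUX C⁺, load-bearing): `φ ∈ St₀ ∩ St₁` fixing
     `N 2 ⊔ N 0 ⊔ M'` with `φ(N₀M' ∩ N₂M') = N₀M' ∩ K'₂M'`]→ `φ`
  —[proved: two-level residue lemma `residue_two_level` in both directions, fed by Stub 4
     transported along `φ` and `χ⁻¹` (`central_transport`)]→ `φ(N 2) ⊔ M = K' 2 ⊔ M`
  —[proved: assemble the three slots, undo `χ`, undo the Waldhausen `α`]→ the crux at level `M`.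

`ShadowsStandard_of (hW : WaldhausenPairs) : …CongruenceShadows.ShadowsStandard` is proved below BY
NAME; its only hypothesis is the route's own item `WaldhausenPairs` (rank-2 crux 14592, published
theorem: LR02 + Kneser–Stallings–Perelman + Waldhausen 1968 + DNB); sorries only inside `stub_*`.

Disproof.lean honoured (cdisprove cycle 1, NO KILL): `shadowsStandard_false_without_trisection` —
`IsGroupTrisection` is an explicit hypothesis of Stubs 1 and 3 and enters Stub 4 through
`IsFreeOfRank (S ⧸ K 2)`; for the junk triple `K = ⊥` Stub 1 is false (no epimorphism onto `F_k`)
and is never claimed. `shadowsStandard_false_without_characteristic` — `M.Characteristic` is a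
hypothesis of Stubs 1, 3, 4 and is USED in the glue (`χ(M') = M'`, `φ(M) = M`: every transport
step). `shadowsStandardWithoutFiniteIndex_iff_unstableStandard` — at `M' = ⊥` Stub 1 would be the
discrete pair statement = stable AC_k (never claimed: `M'.FiniteIndex` is a hypothesis) and Stub 4
is false at `M = ⊥` (centres of `N₀K₂/K₂`-quotients at finite levels are non-trivial), so the line
cannot even be stated without finite index. `uniform_iff_unstableStandard` — every automorphism
produced depends on `M` (through `M'`). §5 refuted strengthening (level gate identity, Lagrangian
`⟨a₁, a₂+b₂, a₃+b₃⟩`) — no level-stabiliser product identity is used anywhere; Stub 3 asks for an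
EXACT element of `St₀ ∩ St₁`, and its hypothesis carries the full trisection axioms of `K'`.
`ledger negatives --problem SmoothPoincare4` = 0 (2026-08-16): no stub restates a refuted statement.
No landed `Theorems/ShadowsStandard/Negative/*` exists (nothing to import in the scratch check).
-/

noncomputable section

set_option linter.dupNamespace false
set_option linter.unusedVariables false

open Literature.Topology.FourManifolds
open Subgroup

namespace Summit.SmoothPoincare4.SmoothPoincare4.Cruxes.ShadowsStandard.FinitaryAcCentralResidue

/-! ## 0. Conventions and sorry-free transport lemmas -/

/-- The standard kernels `s4Kernels.stabilizeIter m i` are normal closures, hence normal; this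
instance makes `SurfaceGroup (3+3m) ⧸ s4Kernels.stabilizeIter m 0` a group (`= π₁(H₀)`). -/
instance stdKernel_normal (m : ℕ) (i : Fin 3) : (s4Kernels.stabilizeIter m i).Normal := by
  cases m with
  | zero =>
    show (s4Kernels i).Normal
    rw [s4Kernels_eq]
    infer_instance
  | succ n =>
    show ((s4Kernels.stabilizeIter n).stabilize i).Normal
    rw [TrisectionKernels.stabilize_apply]
    infer_instance

/-- The standard triple is a group trisection of the trivial group at every `m` (from the two
discharged tree facts `s4Kernels_isGroupTrisection_holds`, `stabilize_isGroupTrisection_holds`). -/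
theorem stabilizeIter_isGroupTrisection (m : ℕ) :
    IsGroupTrisection (3 + 3 * m) (m + 1) (PUnit : Type) (s4Kernels.stabilizeIter m) := by
  induction m with
  | zero => exact s4Kernels_isGroupTrisection_holds
  | succ m ih =>
    exact stabilize_isGroupTrisection_holds (3 + 3 * m) (m + 1) PUnit (s4Kernels.stabilizeIter m) ih

section transport

variable {G : Type*} [Group G]

/-- `H ↦ H.map` along a composite of automorphisms. -/
theorem map_trans (e₁ e₂ : G ≃* G) (H : Subgroup G) :
    H.map (e₁.trans e₂).toMonoidHom = (H.map e₁.toMonoidHom).map e₂.toMonoidHom := by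
  rw [Subgroup.map_map]
  rfl

/-- `e⁻¹` undoes `e` on subgroups. -/
theorem map_map_symm (e : G ≃* G) (H : Subgroup G) :
    (H.map e.toMonoidHom).map e.symm.toMonoidHom = H := by
  ext x
  simp

/-- `e` undoes `e⁻¹` on subgroups. -/
theorem map_symm_map (e : G ≃* G) (H : Subgroup G) :
    (H.map e.symm.toMonoidHom).map e.toMonoidHom = H := by
  ext x
  simp

/-- If `e(H) = K` then `e⁻¹(K) = H`. -/
theorem map_symm_of_map (e : G ≃* G) {H K : Subgroup G} (h : H.map e.toMonoidHom = K) :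
    K.map e.symm.toMonoidHom = H := by
  rw [← h, map_map_symm]

/-- A characteristic subgroup is fixed by every automorphism (as `map`). -/
theorem map_char (e : G ≃* G) {M : Subgroup G} (hM : M.Characteristic) :
    M.map e.toMonoidHom = M :=
  (Subgroup.characteristic_iff_map_eq.mp hM) e

/-- The intersection of two characteristic subgroups is characteristic. -/
theorem characteristic_inf {H K : Subgroup G} (hH : H.Characteristic) (hK : K.Characteristic) :
    (H ⊓ K).Characteristic := by
  rw [Subgroup.characteristic_iff_comap_eq] at *
  intro ϕ
  rw [Subgroup.comap_inf, hH ϕ, hK ϕ]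

/-- Three cases make a statement about `Fin 3`. -/
theorem forall_fin_three {P : Fin 3 → Prop} (h0 : P 0) (h1 : P 1) (h2 : P 2) : ∀ i, P i := by
  intro i
  match i with
  | ⟨0, _⟩ => exact h0
  | ⟨1, _⟩ => exact h1
  | ⟨2, _⟩ => exact h2

end transport

variable {g : ℕ}

/-- **`Aut S_g`-invariance of the group-trisection property**: if `K` is a `(g,k)` group
trisection of `G`, so is `α • K = (α(K₀), α(K₁), α(K₂))` for every automorphism `α` of `S_g`
(each of the seven quotients is transported by `QuotientGroup.congr`). -/
theorem isGroupTrisection_map {k : ℕ} {G : Type*} [Group G] {K : TrisectionKernels g}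
    (hK : IsGroupTrisection g k G K) (α : SurfaceGroup g ≃* SurfaceGroup g) :
    IsGroupTrisection g k G (fun i => (K i).map α.toMonoidHom) := by
  have hsurj : Function.Surjective (α : SurfaceGroup g →* SurfaceGroup g) := α.surjective
  have himg : ∀ i, ((K i).map α.toMonoidHom : Set (SurfaceGroup g)) = α '' (K i) := fun i =>
    Subgroup.coe_map _ _
  have hnc : ∀ s : Set (SurfaceGroup g),
      (Subgroup.normalClosure s).map (α : SurfaceGroup g →* SurfaceGroup g) =
        Subgroup.normalClosure (α '' s) := fun s =>
    Subgroup.map_normalClosure s _ hsurj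
  refine ⟨fun i => (hK.normal i).map α.toMonoidHom α.surjective, fun i => ?_, fun i j hij => ?_, ?_⟩
  · refine (hK.free_quotient i).of_mulEquiv (QuotientGroup.congr _ _ α ?_)
    simp only [hnc, himg]
  · refine (hK.free_pairQuotient i j hij).of_mulEquiv (QuotientGroup.congr _ _ α ?_)
    simp only [hnc, himg, Set.image_union]
  · obtain ⟨e⟩ := hK.triple
    refine ⟨(QuotientGroup.congr _ _ α ?_).symm.trans e⟩
    simp only [hnc, himg, Set.image_iUnion]

variable {m : ℕ}

/-- **Undoing a transport on the conclusion.** Standard shadows for `γ⁻¹ • K` at level `M` give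
standard shadows for `K` at level `M` (`M` characteristic). -/
theorem undo (γ : SurfaceGroup (3 + 3 * m) ≃* SurfaceGroup (3 + 3 * m))
    {K : TrisectionKernels (3 + 3 * m)} {M : Subgroup (SurfaceGroup (3 + 3 * m))}
    (hM : M.Characteristic)
    (h : ∃ ψ : SurfaceGroup (3 + 3 * m) ≃* SurfaceGroup (3 + 3 * m), ∀ i : Fin 3,
      (s4Kernels.stabilizeIter m i ⊔ M).map ψ.toMonoidHom = (K i).map γ.symm.toMonoidHom ⊔ M) :
    ∃ ψ : SurfaceGroup (3 + 3 * m) ≃* SurfaceGroup (3 + 3 * m), ∀ i : Fin 3,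
      (s4Kernels.stabilizeIter m i ⊔ M).map ψ.toMonoidHom = K i ⊔ M := by
  obtain ⟨ψ, hψ⟩ := h
  refine ⟨ψ.trans γ, fun i => ?_⟩
  rw [map_trans, hψ i, Subgroup.map_sup, map_symm_map, map_char γ hM]

/-- **From the quotient back to `S`.** If `χ ∈ Aut S` stabilises `N 0` and induces `θ` on
`F = S ⧸ N 0`, and `θ` carries `π(X)` to `π(Y)`, then `χ(X ⊔ N 0) = Y ⊔ N 0`. -/
theorem sup_map_of_quotient (χ : SurfaceGroup (3 + 3 * m) ≃* SurfaceGroup (3 + 3 * m))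
    (θ : (SurfaceGroup (3 + 3 * m) ⧸ s4Kernels.stabilizeIter m 0) ≃*
      (SurfaceGroup (3 + 3 * m) ⧸ s4Kernels.stabilizeIter m 0))
    (hχ0 : (s4Kernels.stabilizeIter m 0).map χ.toMonoidHom = s4Kernels.stabilizeIter m 0)
    (hχ : ∀ s : SurfaceGroup (3 + 3 * m),
      QuotientGroup.mk' (s4Kernels.stabilizeIter m 0) (χ s) =
        θ (QuotientGroup.mk' (s4Kernels.stabilizeIter m 0) s))
    {X Y : Subgroup (SurfaceGroup (3 + 3 * m))}
    (h : (X.map (QuotientGroup.mk' (s4Kernels.stabilizeIter m 0))).map θ.toMonoidHom =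
      Y.map (QuotientGroup.mk' (s4Kernels.stabilizeIter m 0))) :
    (X ⊔ s4Kernels.stabilizeIter m 0).map χ.toMonoidHom = Y ⊔ s4Kernels.stabilizeIter m 0 := by
  have hcomp : (QuotientGroup.mk' (s4Kernels.stabilizeIter m 0)).comp χ.toMonoidHom =
      θ.toMonoidHom.comp (QuotientGroup.mk' (s4Kernels.stabilizeIter m 0)) :=
    MonoidHom.ext hχ
  have h1 : (X.map χ.toMonoidHom).map (QuotientGroup.mk' (s4Kernels.stabilizeIter m 0)) =
      Y.map (QuotientGroup.mk' (s4Kernels.stabilizeIter m 0)) := by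
    rw [Subgroup.map_map, hcomp, ← Subgroup.map_map, h]
  have h2 : X.map χ.toMonoidHom ⊔ s4Kernels.stabilizeIter m 0 = Y ⊔ s4Kernels.stabilizeIter m 0 := by
    have := congrArg (Subgroup.comap (QuotientGroup.mk' (s4Kernels.stabilizeIter m 0))) h1
    simpa only [Subgroup.comap_map_eq, QuotientGroup.ker_mk'] using this
  rw [Subgroup.map_sup, hχ0, h2]

/-- **Transport of effective centrelessness** along an automorphism `e` fixing `N`, `M'`, `M`:
the statement for `(N, A)` gives the statement for `(N, e(A))`. -/
theorem central_transport {N A M' M : Subgroup (SurfaceGroup (3 + 3 * m))}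
    (e : SurfaceGroup (3 + 3 * m) ≃* SurfaceGroup (3 + 3 * m))
    (heN : N.map e.toMonoidHom = N) (hM' : M'.Characteristic) (hM : M.Characteristic)
    (h : ∀ x ∈ N, (∀ y ∈ N, y * x * y⁻¹ * x⁻¹ ∈ A ⊔ M') → x ∈ A ⊔ M) :
    ∀ x ∈ N, (∀ y ∈ N, y * x * y⁻¹ * x⁻¹ ∈ A.map e.toMonoidHom ⊔ M') → x ∈ A.map e.toMonoidHom ⊔ M := by
  intro x hx hyp
  have heN' : N.map e.symm.toMonoidHom = N := map_symm_of_map e heN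
  -- pull `x` back along `e`
  have hx' : e.symm x ∈ N := by
    rw [← heN']
    exact Subgroup.mem_map_of_mem _ hx
  have key : e.symm x ∈ A ⊔ M := by
    refine h _ hx' fun y hy => ?_
    have hy' : e y ∈ N := by
      rw [← heN]
      exact Subgroup.mem_map_of_mem _ hy
    have hc := hyp (e y) hy'
    -- apply `e⁻¹` to the commutator
    have : e.symm (e y * x * (e y)⁻¹ * x⁻¹) ∈ (A.map e.toMonoidHom ⊔ M').map e.symm.toMonoidHom :=
      Subgroup.mem_map_of_mem _ hc
    rw [Subgroup.map_sup, map_map_symm, map_char e.symm hM'] at this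
    simpa using this
  have : e (e.symm x) ∈ (A ⊔ M).map e.toMonoidHom := Subgroup.mem_map_of_mem _ key
  rw [Subgroup.map_sup, map_char e hM] at this
  simpa using this

/-! ## The two-level RESIDUE LEMMA (proved) — the device that makes the line level-wise

With `N, A, B, M' ≤ M` normal: if `B ≤ A N M'`, `N ∩ B ≤ A M'`, and every element of `N` that is
central in `N` modulo `A M'` already lies in `A M` ("effective centrelessness of `N A/A` between
the levels `M'` and `M`"), then `B ≤ A M`.  Discretely (`M = M' = 1`) this is the card's residue
lemma `residue_le_of_center_trivial` (SketchIdeator2, proved); the point of the two-level form is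
that the centre hypothesis, false at any single finite level (centres of relatively free kernels),
holds between two levels by Melnikov + compactness (Stub 4), so no profinite object is needed. -/

/-- **Residue lemma, two-level form, one inclusion.** -/
theorem residue_two_level {G : Type*} [Group G] (N A B M' M : Subgroup G)
    [N.Normal] [A.Normal] [B.Normal] [M'.Normal] [M.Normal]
    (hle : M' ≤ M) (hB : B ≤ A ⊔ N ⊔ M') (hNB : N ⊓ B ≤ A ⊔ M')
    (hZ : ∀ x ∈ N, (∀ y ∈ N, y * x * y⁻¹ * x⁻¹ ∈ A ⊔ M') → x ∈ A ⊔ M) :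
    B ≤ A ⊔ M := by
  intro b hb
  have hb' : b ∈ N ⊔ (A ⊔ M') := by
    have : A ⊔ N ⊔ M' = N ⊔ (A ⊔ M') := by rw [sup_comm A N, sup_assoc]
    exact this ▸ hB hb
  obtain ⟨n, hn, t, ht, rfl⟩ := (mem_sup_of_normal_left).1 hb'
  have hnA : n ∈ A ⊔ M := by
    refine hZ n hn fun y hy => ?_
    -- c := y (n t) y⁻¹ (n t)⁻¹ ∈ N ⊓ B ≤ A ⊔ M'
    have hc : y * (n * t) * y⁻¹ * (n * t)⁻¹ ∈ A ⊔ M' := by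
      apply hNB
      refine ⟨?_, ?_⟩
      · have h1 : (n * t) * y⁻¹ * (n * t)⁻¹ ∈ N :=
          Normal.conj_mem inferInstance y⁻¹ (N.inv_mem hy) (n * t)
        have := N.mul_mem hy h1
        simpa [mul_assoc] using this
      · have h1 : y * (n * t) * y⁻¹ ∈ B := Normal.conj_mem inferInstance (n * t) hb y
        exact B.mul_mem h1 (B.inv_mem hb)
    -- d := n (y t y⁻¹ t⁻¹) n⁻¹ ∈ A ⊔ M'
    have hd : n * (y * t * y⁻¹ * t⁻¹) * n⁻¹ ∈ A ⊔ M' := by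
      have h1 : y * t * y⁻¹ ∈ A ⊔ M' := Normal.conj_mem inferInstance t ht y
      have h2 : y * t * y⁻¹ * t⁻¹ ∈ A ⊔ M' := (A ⊔ M').mul_mem h1 ((A ⊔ M').inv_mem ht)
      exact Normal.conj_mem inferInstance _ h2 n
    have key : y * n * y⁻¹ * n⁻¹ =
        (y * (n * t) * y⁻¹ * (n * t)⁻¹) * (n * (y * t * y⁻¹ * t⁻¹) * n⁻¹)⁻¹ := by
      group
    rw [key]
    exact (A ⊔ M').mul_mem hc ((A ⊔ M').inv_mem hd)
  have ht' : t ∈ A ⊔ M := (sup_le_sup_left hle A) ht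
  exact (A ⊔ M).mul_mem hnA ht'

/-- **Residue lemma, two-level symmetric form**: `A M = B M`. -/
theorem residue_two_level_eq {G : Type*} [Group G] (N A B M' M : Subgroup G)
    [N.Normal] [A.Normal] [B.Normal] [M'.Normal] [M.Normal]
    (hle : M' ≤ M)
    (hB : B ≤ A ⊔ N ⊔ M') (hA : A ≤ B ⊔ N ⊔ M')
    (hNB : N ⊓ B ≤ A ⊔ M') (hNA : N ⊓ A ≤ B ⊔ M')
    (hZA : ∀ x ∈ N, (∀ y ∈ N, y * x * y⁻¹ * x⁻¹ ∈ A ⊔ M') → x ∈ A ⊔ M)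
    (hZB : ∀ x ∈ N, (∀ y ∈ N, y * x * y⁻¹ * x⁻¹ ∈ B ⊔ M') → x ∈ B ⊔ M) :
    A ⊔ M = B ⊔ M := by
  apply le_antisymm
  · exact sup_le ((residue_two_level N B A M' M hle hA hNA hZB).trans le_rfl) le_sup_right
  · exact sup_le (residue_two_level N A B M' M hle hB hNB hZA) le_sup_right

/-! ## 1. FINITARY ANDREWS–CURTIS NORMAL FORM in `F = S ⧸ N 0` (Borovik–Lubotzky–Myasnikov)

Stub 1 · `stub_finitaryAC` · for a slot-normalised `(3+3m; m+1)` group trisection `(N 0, N 1, K 2)`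
of `{1}` and a characteristic finite-index level `M ≤ S`, some automorphism `θ` of the free group
`F = S ⧸ N 0 = π₁(H₀)` (rank `3k`, `k = m+1`) preserves `R₁ = π(N 1)` (the normal closure of the
`2k` tails) and carries `π(N 2 ⊔ M)` to `π(K 2 ⊔ M)`.  Engines: Nielsen (every epimorphism
`F_{3k} ↠ F_k` is `Aut F_{3k}`-standard, Lyndon–Schupp I.2; the targets `F/π(K 2) ≅ S/(N₀K₂)` and
`F/π(N 2)` are free of rank `k` by `free_pairQuotient 0 2`), so that `W := q(π M) ≤ F_k` does not
depend on the epimorphism once `π(M)` is `Aut F`-invariant (Luft: `Stab(N 0) ↠ Aut F`; or pass to a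
verbal level first, Disproof §2); BLM's finitary AC theorem (Borovik–Lubotzky–Myasnikov 2005 =
Myropolska arXiv:1304.2668 Thm 1.2, READ p.3: in a finite group `G`, `n ≥ max(w(G),2)`, normally
generating `n`-tuples are AC-equivalent iff their images in `Ab G` are; here `G = F_k/W`,
`n = 2k ≥ max(k,2) ≥ w(G)`, and `2k ≥ rank(Ab G)+1` makes the abelian classes one class by
Diaconis–Graham / Neumann–Neumann, Myropolska Thm 1.1) applied to the tail tuple `q̄(tails)`, which
normally generates `G` because `N₀N₁K₂ = S` (`triple`); the RESERVOIR / move-realisation lemma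
(the AC-moves of BLM and the final head reset are induced by elements of `Stab_{Aut F}(R₁)`:
Nielsen moves of the tail factor, tail conjugations by heads and other tails, head transvections;
triage toys r1-2/r1-3: ONE orbit for `G = S₃, D₄, Q₈, A₄` at `k = 2`).  Kernel equality (not tuple
equality) is all that is claimed, so the residual `Aut G` ambiguity of BLM is harmless.
WHY IT MIGHT FAIL: the reservoir lemma at a level where no tail is trivial (fallback: one
stabilisation, card "Honest bet"); at `M = ⊥` the statement is stable AC_k — never claimed.
Size L (m = 0: provable now, `F₃ ↠ ℤ` unique; the finite-group combinatorics is M, the free-group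
bookkeeping in `PresentedGroup` is the cost). -/
theorem stub_finitaryAC :
    ∀ (m : ℕ) (K : TrisectionKernels (3 + 3 * m)),
      IsGroupTrisection (3 + 3 * m) (m + 1) (PUnit : Type) K →
      K 0 = s4Kernels.stabilizeIter m 0 → K 1 = s4Kernels.stabilizeIter m 1 →
      ∀ M : Subgroup (SurfaceGroup (3 + 3 * m)), M.Characteristic → M.FiniteIndex →
      ∃ θ : (SurfaceGroup (3 + 3 * m) ⧸ s4Kernels.stabilizeIter m 0) ≃*
          (SurfaceGroup (3 + 3 * m) ⧸ s4Kernels.stabilizeIter m 0),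
        ((s4Kernels.stabilizeIter m 1).map (QuotientGroup.mk' (s4Kernels.stabilizeIter m 0))).map
            θ.toMonoidHom =
          (s4Kernels.stabilizeIter m 1).map (QuotientGroup.mk' (s4Kernels.stabilizeIter m 0)) ∧
        ((s4Kernels.stabilizeIter m 2 ⊔ M).map (QuotientGroup.mk' (s4Kernels.stabilizeIter m 0))).map
            θ.toMonoidHom =
          (K 2 ⊔ M).map (QuotientGroup.mk' (s4Kernels.stabilizeIter m 0)) := by
  sorry

/-! ## 2. GOERITZ REALISATION `GR_k`: `St₀ ∩ St₁ ↠ Stab_{Aut F}(R₁)`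

Stub 2 · `stub_goeritzRealisation` · every automorphism `θ` of `F = S ⧸ N 0 = π₁(H₀)` preserving
`R₁ = π(N 1) = ker(π₁H₀ → π₁(H₀ ∪ H₁))` is induced by an automorphism `χ` of the surface group
fixing BOTH `N 0` and `N 1` — the (based, ±) Goeritz group of the standard genus-`3k` Heegaard
splitting of `#ᵏ S¹×S²` realises the whole stabiliser of the tail normal closure.  Engines:
Luft 1978 / Zieschang (`MCG±(H₀,∗) ↠ Aut F`, kernel = McCullough's twist group), Laudenbach 1973
(`Diff(#ᵏS¹×S²) ↠ Out F_k`, kernel the sphere twists), Waldhausen 1968 (Heegaard splittings of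
`#ᵏS¹×S²` are standard; the isotopy/`Diff` bookkeeping between Goeritz group, handlebody group
and `Diff` via Johnson–McCullough arXiv:1011.0702), and slides of any handle of `H₀` over
(conjugates of) TAIL handles inside `H₀ ∪ H₁`, whole-handle conjugations and signed permutations,
realising the relative Nielsen generators of `Stab_{Aut F}(R₁) = {θ | θ(tails) ⊆ R₁}` (Hopfian
argument for the equality); for the `S³`-summand the Goeritz group realises all of `Aut F_{2k}`
(order-4 signed swap and order-3 `θ`-graph symmetry generate `SL₂(ℤ)` on a pair of handles).  Shared support claim of
three cards (this one's `GR_k`, luft-twist-normal-form's `RGL`, handlebody-faces' `G₀₁`; triage r1-2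
cross-card note) — one proof serves all.  WHY IT MIGHT FAIL: the kernel of
`Stab_{Aut F}(R₁) → Aut(F/R₁)` is an infinitely generated relative-IA group and only its slide part
is visibly geometric; a non-geometric element there kills the exact form (the level-`M` form
`χ(N 1 ⊔ M) = N 1 ⊔ M`, which is all the composition uses of slot 1, would survive).  Size L. -/
theorem stub_goeritzRealisation :
    ∀ (m : ℕ) (θ : (SurfaceGroup (3 + 3 * m) ⧸ s4Kernels.stabilizeIter m 0) ≃*
        (SurfaceGroup (3 + 3 * m) ⧸ s4Kernels.stabilizeIter m 0)),
      ((s4Kernels.stabilizeIter m 1).map (QuotientGroup.mk' (s4Kernels.stabilizeIter m 0))).map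
          θ.toMonoidHom =
        (s4Kernels.stabilizeIter m 1).map (QuotientGroup.mk' (s4Kernels.stabilizeIter m 0)) →
      ∃ χ : SurfaceGroup (3 + 3 * m) ≃* SurfaceGroup (3 + 3 * m),
        (s4Kernels.stabilizeIter m 0).map χ.toMonoidHom = s4Kernels.stabilizeIter m 0 ∧
        (s4Kernels.stabilizeIter m 1).map χ.toMonoidHom = s4Kernels.stabilizeIter m 1 ∧
        ∀ s : SurfaceGroup (3 + 3 * m),
          QuotientGroup.mk' (s4Kernels.stabilizeIter m 0) (χ s) =
            θ (QuotientGroup.mk' (s4Kernels.stabilizeIter m 0) s) := by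
  sorry

/-! ## 3. INTERSECTION RIGIDITY (the residue crux C⁺, level-wise) — LOAD-BEARING

Stub 3 · `stub_intersectionRigidity` · for a slot-normalised trisection `(N 0, N 1, K 2)` of `{1}`
already in finitary-AC normal form at the characteristic finite-index level `M`
(`K 2 ⊔ N 0 ⊔ M = N 2 ⊔ N 0 ⊔ M`), some EXACT Goeritz element `φ ∈ St₀ ∩ St₁` fixes
`N 2 ⊔ N 0 ⊔ M` and carries the standard double intersection `N₀M ∩ N₂M` to `N₀M ∩ K₂M`.
This is the card's Transfer in residue coordinates, with the coherent/profinite clause REMOVED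
(the two-level residue lemma makes the level-wise form sufficient).  Sandwiched:
`UnstableStandard ⇒` Stub 3 (take `φ = α`, the isomorphism `N ≅ K`) and Stubs 1–4 `⇒` crux; not
implied by the crux (level stabilisers are bigger than `St₀ ∩ St₁` already at the abelian level,
`GL_g(ℤ) → GL_g(𝔽_p)` not onto).  The object is ONE normal subgroup of the finite group `S/M`
inside `N₀M/M`: discretely `(N₀ ∩ K₂)/[N₀,K₂] ≅ π₂(H₀ ∪ H₂′) = π₂(#ᵏS¹×S²)` (Brown–Loday /
Gutiérrez–Ratcliffe), the module of REDUCING SPHERES of the `(0,2′)` splitting, on which the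
Goeritz group of the STANDARD `(0,1)` splitting acts; at `m = 0` it is generated over `[N₀,N₂]` by
the common meridian `a₂` (triage r1-3 correction: `a₂`, not `a₁`, in the tree frame
`N = (⟪a₁,a₂,b₃⟫, ⟪a₁,b₂,a₃⟫, ⟪b₁,a₂,a₃⟫)`).  WHY IT MIGHT FAIL: it is stronger than the crux
at each level (exact `St₀ ∩ St₁`): a non-standard balanced trisection of `S⁴` (MSZ Conj. 3.11,
"likely false") with standard shadows could violate it at deep levels; at `m = 0` it carries the
whole genus-3 content (Aranda–Zupan arXiv:2503.04607 Q 8.2/8.3).  Size: open-problem-sized at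
`m = 0`; the line's bet is that it is the RIGHT residual (abelian-group-valued obstruction
`Hom_Q(B₂/D_M, Z(B₀/D_M))` per level, reducing-curve generators, relation-module layers). -/
theorem stub_intersectionRigidity :
    ∀ (m : ℕ) (K : TrisectionKernels (3 + 3 * m)),
      IsGroupTrisection (3 + 3 * m) (m + 1) (PUnit : Type) K →
      K 0 = s4Kernels.stabilizeIter m 0 → K 1 = s4Kernels.stabilizeIter m 1 →
      ∀ M : Subgroup (SurfaceGroup (3 + 3 * m)), M.Characteristic → M.FiniteIndex →
      K 2 ⊔ s4Kernels.stabilizeIter m 0 ⊔ M =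
        s4Kernels.stabilizeIter m 2 ⊔ s4Kernels.stabilizeIter m 0 ⊔ M →
      ∃ φ : SurfaceGroup (3 + 3 * m) ≃* SurfaceGroup (3 + 3 * m),
        (s4Kernels.stabilizeIter m 0).map φ.toMonoidHom = s4Kernels.stabilizeIter m 0 ∧
        (s4Kernels.stabilizeIter m 1).map φ.toMonoidHom = s4Kernels.stabilizeIter m 1 ∧
        (s4Kernels.stabilizeIter m 2 ⊔ s4Kernels.stabilizeIter m 0 ⊔ M).map φ.toMonoidHom =
          s4Kernels.stabilizeIter m 2 ⊔ s4Kernels.stabilizeIter m 0 ⊔ M ∧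
        ((s4Kernels.stabilizeIter m 0 ⊔ M) ⊓ (s4Kernels.stabilizeIter m 2 ⊔ M)).map φ.toMonoidHom =
          (s4Kernels.stabilizeIter m 0 ⊔ M) ⊓ (K 2 ⊔ M) := by
  sorry

/-! ## 4. EFFECTIVE CENTRELESSNESS between two levels (Melnikov + compactness, discrete form)

Stub 4 · `stub_effectiveCentreless` · let `A, B ⊴ S = S_{3+3m}` with `S ⧸ B` free of rank `3+3m`
(e.g. `B` a handlebody kernel). For every characteristic finite-index `M` there is a deeper
characteristic finite-index `M' ≤ M` such that an element of `A` that is central in `A` modulo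
`B ⊔ M'` lies in `B ⊔ M`.  Proof route: in `F = S/B ≅ F_g` (`g ≥ 3`) let `R = AB/B ⊴ F`; the closure
`R̄` of `R` in the profinite completion `F̂` is a closed normal subgroup of a free profinite group of
rank `≥ 2`, hence trivial or free profinite non-abelian (Melnikov 1978; Ribes–Zalesskii,
*Profinite Groups*, §8.6–8.7 / Thm 3.6.2-type structure of normal subgroups), so `Z(R̄) = 1`; the
closed sets `C_V = {x ∈ R̄ ∖ Û : [R̄, x] ⊆ V}` (`U = image of M`, `V` open normal) decrease to
`Z(R̄) ∖ Û = ∅`, so by compactness one `C_V` is empty; take `M'` = a characteristic finite-index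
subgroup of `S` inside `M ∩ (preimage of V)` (characteristic cores of finite-index subgroups of the
finitely generated `S` have finite index); density of `R` in `R̄` and `Û ∩ F = U` finish.
(Mathlib: `ProfiniteGrp.Completion`; or argue with the inverse system of finite quotients
directly.)  It is applied twice, to `(N 0, N 2)` and `(N 0, K 2)`, and transported along
automorphisms fixing `N 0` (`central_transport`).  WHY IT MIGHT FAIL: it does not (a theorem); the
risk is formalisation cost (no profinite completion of an abstract group with the needed API in
the tree).  Size L. -/
theorem stub_effectiveCentreless :
    ∀ (m : ℕ) (A B : Subgroup (SurfaceGroup (3 + 3 * m))) [A.Normal] [B.Normal],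
      IsFreeOfRank (SurfaceGroup (3 + 3 * m) ⧸ B) (3 + 3 * m) →
      ∀ M : Subgroup (SurfaceGroup (3 + 3 * m)), M.Characteristic → M.FiniteIndex →
      ∃ M' : Subgroup (SurfaceGroup (3 + 3 * m)), M'.Characteristic ∧ M'.FiniteIndex ∧ M' ≤ M ∧
        ∀ x ∈ A, (∀ y ∈ A, y * x * y⁻¹ * x⁻¹ ∈ B ⊔ M') → x ∈ B ⊔ M := by
  sorry

/-! ## 4½. Sandwich certificates (sorry-free): the two `K`-dependent stubs follow from `N ≅ K`

If the slot-normalised triple `K` is isomorphic to the standard one (`UnstableStandard` of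
Disproof §1 restricted to slot-normalised triples — in AGK's dictionary SPC4 ∧ balanced 4-d
Waldhausen), then Stub 1 and Stub 3 hold for `K` with `θ = ᾱ`, `φ = α`.  So neither stub can be
refuted without exhibiting a balanced group trisection of `{1}` not isomorphic to the standard one
at its own genus (an exotic `S⁴` or a counterexample to MSZ Conj. 3.11); and the certificates
check that the two statements are not mis-typed. Stubs 2 and 4 do not mention `K`. -/

/-- **Sandwich for Stub 3.** -/
theorem intersectionRigidity_of_iso (m : ℕ) (K : TrisectionKernels (3 + 3 * m))
    (α : SurfaceGroup (3 + 3 * m) ≃* SurfaceGroup (3 + 3 * m))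
    (hα : ∀ i : Fin 3, (s4Kernels.stabilizeIter m i).map α.toMonoidHom = K i)
    (h0 : K 0 = s4Kernels.stabilizeIter m 0) (h1 : K 1 = s4Kernels.stabilizeIter m 1)
    (M : Subgroup (SurfaceGroup (3 + 3 * m))) (hM : M.Characteristic)
    (hsup : K 2 ⊔ s4Kernels.stabilizeIter m 0 ⊔ M =
      s4Kernels.stabilizeIter m 2 ⊔ s4Kernels.stabilizeIter m 0 ⊔ M) :
    ∃ φ : SurfaceGroup (3 + 3 * m) ≃* SurfaceGroup (3 + 3 * m),
      (s4Kernels.stabilizeIter m 0).map φ.toMonoidHom = s4Kernels.stabilizeIter m 0 ∧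
      (s4Kernels.stabilizeIter m 1).map φ.toMonoidHom = s4Kernels.stabilizeIter m 1 ∧
      (s4Kernels.stabilizeIter m 2 ⊔ s4Kernels.stabilizeIter m 0 ⊔ M).map φ.toMonoidHom =
        s4Kernels.stabilizeIter m 2 ⊔ s4Kernels.stabilizeIter m 0 ⊔ M ∧
      ((s4Kernels.stabilizeIter m 0 ⊔ M) ⊓ (s4Kernels.stabilizeIter m 2 ⊔ M)).map φ.toMonoidHom =
        (s4Kernels.stabilizeIter m 0 ⊔ M) ⊓ (K 2 ⊔ M) := by
  have hα0 : (s4Kernels.stabilizeIter m 0).map α.toMonoidHom = s4Kernels.stabilizeIter m 0 := by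
    rw [hα 0, h0]
  refine ⟨α, hα0, by rw [hα 1, h1], ?_, ?_⟩
  · rw [Subgroup.map_sup, Subgroup.map_sup, hα 2, hα0, map_char α hM, hsup]
  · rw [Subgroup.map_inf_eq _ _ _ α.injective, Subgroup.map_sup, Subgroup.map_sup, hα0, hα 2,
      map_char α hM]

/-- **Sandwich for Stub 1.** -/
theorem finitaryAC_of_iso (m : ℕ) (K : TrisectionKernels (3 + 3 * m))
    (α : SurfaceGroup (3 + 3 * m) ≃* SurfaceGroup (3 + 3 * m))
    (hα : ∀ i : Fin 3, (s4Kernels.stabilizeIter m i).map α.toMonoidHom = K i)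
    (h0 : K 0 = s4Kernels.stabilizeIter m 0) (h1 : K 1 = s4Kernels.stabilizeIter m 1)
    (M : Subgroup (SurfaceGroup (3 + 3 * m))) (hM : M.Characteristic) :
    ∃ θ : (SurfaceGroup (3 + 3 * m) ⧸ s4Kernels.stabilizeIter m 0) ≃*
        (SurfaceGroup (3 + 3 * m) ⧸ s4Kernels.stabilizeIter m 0),
      ((s4Kernels.stabilizeIter m 1).map (QuotientGroup.mk' (s4Kernels.stabilizeIter m 0))).map
          θ.toMonoidHom =
        (s4Kernels.stabilizeIter m 1).map (QuotientGroup.mk' (s4Kernels.stabilizeIter m 0)) ∧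
      ((s4Kernels.stabilizeIter m 2 ⊔ M).map (QuotientGroup.mk' (s4Kernels.stabilizeIter m 0))).map
          θ.toMonoidHom =
        (K 2 ⊔ M).map (QuotientGroup.mk' (s4Kernels.stabilizeIter m 0)) := by
  have hα0 : (s4Kernels.stabilizeIter m 0).map α.toMonoidHom = s4Kernels.stabilizeIter m 0 := by
    rw [hα 0, h0]
  have hα0' : (s4Kernels.stabilizeIter m 0).map ↑α = s4Kernels.stabilizeIter m 0 := hα0
  refine ⟨QuotientGroup.congr (s4Kernels.stabilizeIter m 0) (s4Kernels.stabilizeIter m 0) α hα0',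
    ?_, ?_⟩
  · have nat : (QuotientGroup.congr (s4Kernels.stabilizeIter m 0) (s4Kernels.stabilizeIter m 0) α
          hα0').toMonoidHom.comp (QuotientGroup.mk' (s4Kernels.stabilizeIter m 0)) =
        (QuotientGroup.mk' (s4Kernels.stabilizeIter m 0)).comp α.toMonoidHom := by
      ext x; rfl
    rw [Subgroup.map_map, nat, ← Subgroup.map_map, hα 1, h1]
  · have nat : (QuotientGroup.congr (s4Kernels.stabilizeIter m 0) (s4Kernels.stabilizeIter m 0) α
          hα0').toMonoidHom.comp (QuotientGroup.mk' (s4Kernels.stabilizeIter m 0)) =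
        (QuotientGroup.mk' (s4Kernels.stabilizeIter m 0)).comp α.toMonoidHom := by
      ext x; rfl
    rw [Subgroup.map_map, nat, ← Subgroup.map_map, Subgroup.map_sup, hα 2, map_char α hM]

/-! ## 5. Composition (sorry-free glue): the four stubs + `WaldhausenPairs` prove the crux BY NAME -/

/-- **One level step on a slot-normalised triple.** Given levels `M' ≤ M` (both characteristic of
finite index) such that effective centrelessness holds between them for `(N 0, N 2)` and
`(N 0, K 2)`, the shadow of `K = (N 0, N 1, K 2)` at level `M` is standard.  Stub 1 + Stub 2 give
the normal form `χ`; Stub 3 gives `φ` for `χ⁻¹ • K`; the two-level residue lemma concludes. -/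
theorem level_step (m : ℕ) (K : TrisectionKernels (3 + 3 * m))
    (hK : IsGroupTrisection (3 + 3 * m) (m + 1) (PUnit : Type) K)
    (h0 : K 0 = s4Kernels.stabilizeIter m 0) (h1 : K 1 = s4Kernels.stabilizeIter m 1)
    (M M' : Subgroup (SurfaceGroup (3 + 3 * m)))
    (hM : M.Characteristic) (hM' : M'.Characteristic) (hM'f : M'.FiniteIndex) (hle : M' ≤ M)
    (hZN : ∀ x ∈ s4Kernels.stabilizeIter m 0, (∀ y ∈ s4Kernels.stabilizeIter m 0,
        y * x * y⁻¹ * x⁻¹ ∈ s4Kernels.stabilizeIter m 2 ⊔ M') → x ∈ s4Kernels.stabilizeIter m 2 ⊔ M)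
    (hZK : ∀ x ∈ s4Kernels.stabilizeIter m 0, (∀ y ∈ s4Kernels.stabilizeIter m 0,
        y * x * y⁻¹ * x⁻¹ ∈ K 2 ⊔ M') → x ∈ K 2 ⊔ M) :
    ∃ ψ : SurfaceGroup (3 + 3 * m) ≃* SurfaceGroup (3 + 3 * m), ∀ i : Fin 3,
      (s4Kernels.stabilizeIter m i ⊔ M).map ψ.toMonoidHom = K i ⊔ M := by
  haveI hMn : M.Normal := by haveI := hM; infer_instance
  haveI hM'n : M'.Normal := by haveI := hM'; infer_instance
  haveI hK2n : (K 2).Normal := hK.normal 2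
  -- Stub 1: finitary AC normal form in `F = S ⧸ N 0` at level `M'`
  obtain ⟨θ, hθ1, hθ2⟩ := stub_finitaryAC m K hK h0 h1 M' hM' hM'f
  -- Stub 2: Goeritz realisation of `θ`
  obtain ⟨χ, hχ0, hχ1, hχ⟩ := stub_goeritzRealisation m θ hθ1
  have hχ2 : (s4Kernels.stabilizeIter m 2 ⊔ M' ⊔ s4Kernels.stabilizeIter m 0).map χ.toMonoidHom =
      K 2 ⊔ M' ⊔ s4Kernels.stabilizeIter m 0 :=
    sup_map_of_quotient χ θ hχ0 hχ hθ2
  -- `K' := χ⁻¹ • K` is slot-normalised, a trisection of `{1}`, and in normal form at level `M'`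
  have hK' : IsGroupTrisection (3 + 3 * m) (m + 1) (PUnit : Type)
      (fun i => (K i).map χ.symm.toMonoidHom) := isGroupTrisection_map hK χ.symm
  have h0' : (K 0).map χ.symm.toMonoidHom = s4Kernels.stabilizeIter m 0 := by
    rw [h0]; exact map_symm_of_map χ hχ0
  have h1' : (K 1).map χ.symm.toMonoidHom = s4Kernels.stabilizeIter m 1 := by
    rw [h1]; exact map_symm_of_map χ hχ1
  have hsup' : (K 2).map χ.symm.toMonoidHom ⊔ s4Kernels.stabilizeIter m 0 ⊔ M' =
      s4Kernels.stabilizeIter m 2 ⊔ s4Kernels.stabilizeIter m 0 ⊔ M' := by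
    have := congrArg (Subgroup.map χ.symm.toMonoidHom) hχ2
    rw [map_map_symm, Subgroup.map_sup, Subgroup.map_sup, map_char χ.symm hM',
      map_symm_of_map χ hχ0] at this
    -- this : N 2 ⊔ M' ⊔ N 0 = K' 2 ⊔ M' ⊔ N 0
    rw [sup_right_comm, ← this, sup_right_comm]
  haveI hK'2n : ((K 2).map χ.symm.toMonoidHom).Normal := hK'.normal 2
  -- Stub 3: intersection rigidity for `K'` at level `M'`
  obtain ⟨φ, hφ0, hφ1, hφ2, hφ3⟩ :=
    stub_intersectionRigidity m (fun i => (K i).map χ.symm.toMonoidHom) hK' h0' h1' M' hM' hM'f hsup'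
  haveI hAn : ((s4Kernels.stabilizeIter m 2).map φ.toMonoidHom).Normal :=
    Subgroup.Normal.map inferInstance _ φ.surjective
  -- the two-level residue lemma: `φ(N 2) ⊔ M = K' 2 ⊔ M`
  have hφM' : M'.map φ.toMonoidHom = M' := map_char φ hM'
  have hφM : M.map φ.toMonoidHom = M := map_char φ hM
  have hφ2' : (s4Kernels.stabilizeIter m 2).map φ.toMonoidHom ⊔ s4Kernels.stabilizeIter m 0 ⊔ M' =
      s4Kernels.stabilizeIter m 2 ⊔ s4Kernels.stabilizeIter m 0 ⊔ M' := by
    rw [← hφ2, Subgroup.map_sup, Subgroup.map_sup, hφ0, hφM']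
  have key : (s4Kernels.stabilizeIter m 2).map φ.toMonoidHom ⊔ M =
      (K 2).map χ.symm.toMonoidHom ⊔ M := by
    refine residue_two_level_eq (s4Kernels.stabilizeIter m 0)
      ((s4Kernels.stabilizeIter m 2).map φ.toMonoidHom) ((K 2).map χ.symm.toMonoidHom) M' M hle
      ?_ ?_ ?_ ?_ ?_ ?_
    · -- (a)  K' 2 ≤ φ(N 2) ⊔ N 0 ⊔ M'
      rw [hφ2', ← hsup']
      exact le_sup_left.trans le_sup_left
    · -- (a') φ(N 2) ≤ K' 2 ⊔ N 0 ⊔ M'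
      rw [hsup', ← hφ2']
      exact le_sup_left.trans le_sup_left
    · -- (b)  N 0 ⊓ K' 2 ≤ φ(N 2) ⊔ M'
      calc s4Kernels.stabilizeIter m 0 ⊓ (K 2).map χ.symm.toMonoidHom
          ≤ (s4Kernels.stabilizeIter m 0 ⊔ M') ⊓ ((K 2).map χ.symm.toMonoidHom ⊔ M') :=
            inf_le_inf le_sup_left le_sup_left
        _ = ((s4Kernels.stabilizeIter m 0 ⊔ M') ⊓ (s4Kernels.stabilizeIter m 2 ⊔ M')).map
              φ.toMonoidHom := hφ3.symm
        _ ≤ (s4Kernels.stabilizeIter m 2 ⊔ M').map φ.toMonoidHom := Subgroup.map_mono inf_le_right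
        _ = (s4Kernels.stabilizeIter m 2).map φ.toMonoidHom ⊔ M' := by
            rw [Subgroup.map_sup, hφM']
    · -- (b') N 0 ⊓ φ(N 2) ≤ K' 2 ⊔ M'
      calc s4Kernels.stabilizeIter m 0 ⊓ (s4Kernels.stabilizeIter m 2).map φ.toMonoidHom
          ≤ (s4Kernels.stabilizeIter m 0 ⊔ M') ⊓
              ((s4Kernels.stabilizeIter m 2).map φ.toMonoidHom ⊔ M') :=
            inf_le_inf le_sup_left le_sup_left
        _ = ((s4Kernels.stabilizeIter m 0 ⊔ M') ⊓ (s4Kernels.stabilizeIter m 2 ⊔ M')).map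
              φ.toMonoidHom := by
            rw [Subgroup.map_inf_eq _ _ _ φ.injective, Subgroup.map_sup, Subgroup.map_sup, hφ0,
              hφM']
        _ = (s4Kernels.stabilizeIter m 0 ⊔ M') ⊓ ((K 2).map χ.symm.toMonoidHom ⊔ M') := hφ3
        _ ≤ (K 2).map χ.symm.toMonoidHom ⊔ M' := inf_le_right
    · -- (c)  effective centrelessness for `(N 0, φ(N 2))`, transported along `φ`
      exact central_transport φ hφ0 hM' hM hZN
    · -- (c') effective centrelessness for `(N 0, K' 2 = χ⁻¹(K 2))`, transported along `χ⁻¹`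
      exact central_transport χ.symm (map_symm_of_map χ hχ0) hM' hM hZK
  -- assemble the three slots for `K'`, then undo `χ`
  refine undo χ hM ⟨φ, forall_fin_three ?_ ?_ ?_⟩
  · show (s4Kernels.stabilizeIter m 0 ⊔ M).map φ.toMonoidHom = (K 0).map χ.symm.toMonoidHom ⊔ M
    rw [Subgroup.map_sup, hφ0, hφM, h0']
  · show (s4Kernels.stabilizeIter m 1 ⊔ M).map φ.toMonoidHom = (K 1).map χ.symm.toMonoidHom ⊔ M
    rw [Subgroup.map_sup, hφ1, hφM, h1']
  · show (s4Kernels.stabilizeIter m 2 ⊔ M).map φ.toMonoidHom = (K 2).map χ.symm.toMonoidHom ⊔ M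
    rw [Subgroup.map_sup, hφM, key]

/-- **The crux on slot-normalised triples** (`K 0 = N 0`, `K 1 = N 1`): Stub 4 (twice) supplies the
deeper level `M' = M₁ ⊓ M₂`; `level_step` does the rest. -/
theorem normalised_case (m : ℕ) (K : TrisectionKernels (3 + 3 * m))
    (hK : IsGroupTrisection (3 + 3 * m) (m + 1) (PUnit : Type) K)
    (h0 : K 0 = s4Kernels.stabilizeIter m 0) (h1 : K 1 = s4Kernels.stabilizeIter m 1)
    (M : Subgroup (SurfaceGroup (3 + 3 * m))) (hM : M.Characteristic) (hMf : M.FiniteIndex) :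
    ∃ ψ : SurfaceGroup (3 + 3 * m) ≃* SurfaceGroup (3 + 3 * m), ∀ i : Fin 3,
      (s4Kernels.stabilizeIter m i ⊔ M).map ψ.toMonoidHom = K i ⊔ M := by
  haveI hK2n : (K 2).Normal := hK.normal 2
  have hfreeN : IsFreeOfRank (SurfaceGroup (3 + 3 * m) ⧸ s4Kernels.stabilizeIter m 2) (3 + 3 * m) :=
    ((stabilizeIter_isGroupTrisection m).free_quotient 2).of_mulEquiv
      (QuotientGroup.quotientMulEquivOfEq (normalClosure_eq_self _))
  have hfreeK : IsFreeOfRank (SurfaceGroup (3 + 3 * m) ⧸ K 2) (3 + 3 * m) :=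
    (hK.free_quotient 2).of_mulEquiv (QuotientGroup.quotientMulEquivOfEq (normalClosure_eq_self _))
  obtain ⟨M₁, hM₁c, hM₁f, hM₁le, hZ₁⟩ :=
    stub_effectiveCentreless m (s4Kernels.stabilizeIter m 0) (s4Kernels.stabilizeIter m 2) hfreeN
      M hM hMf
  obtain ⟨M₂, hM₂c, hM₂f, hM₂le, hZ₂⟩ :=
    stub_effectiveCentreless m (s4Kernels.stabilizeIter m 0) (K 2) hfreeK M hM hMf
  haveI := hM₁f
  haveI := hM₂f
  refine level_step m K hK h0 h1 M (M₁ ⊓ M₂) hM (characteristic_inf hM₁c hM₂c) inferInstance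
    (inf_le_left.trans hM₁le) ?_ ?_
  · intro x hx h
    have hmono : s4Kernels.stabilizeIter m 2 ⊔ (M₁ ⊓ M₂) ≤ s4Kernels.stabilizeIter m 2 ⊔ M₁ :=
      sup_le_sup_left inf_le_left _
    exact hZ₁ x hx fun y hy => hmono (h y hy)
  · intro x hx h
    have hmono : K 2 ⊔ (M₁ ⊓ M₂) ≤ K 2 ⊔ M₂ := sup_le_sup_left inf_le_right _
    exact hZ₂ x hx fun y hy => hmono (h y hy)

/-- **Composition.** The four stubs prove the crux `CongruenceShadows.ShadowsStandard` BY NAME,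
given the route's own item `WaldhausenPairs` (slot normalisation of the pair `(0,1)`): transport
`K` along the inverse of the Waldhausen automorphism `α`, apply `normalised_case`, undo `α`. -/
theorem ShadowsStandard_of
    (hW : _root_.Summit.SmoothPoincare4.SmoothPoincare4.Theses.CongruenceShadows.WaldhausenPairs) :
    _root_.Summit.SmoothPoincare4.SmoothPoincare4.Theses.CongruenceShadows.ShadowsStandard := by
  intro m K hK M hM hMf
  obtain ⟨α, hα0, hα1⟩ := hW m K hK 0 1 (by decide)
  exact undo α hM
    (normalised_case m (fun i => (K i).map α.symm.toMonoidHom) (isGroupTrisection_map hK α.symm)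
      (map_symm_of_map α hα0) (map_symm_of_map α hα1) M hM hMf)

end Summit.SmoothPoincare4.SmoothPoincare4.Cruxes.ShadowsStandard.FinitaryAcCentralResidue

end
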